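import Summits.QuantumFields.YangMills.Theorems.ColdStartUniversalityLindebergSwapLoopLaw
import Summits.QuantumFields.YangMills.Theorems.ColdStartUniversalityLindebergSwapGuardSphereNull
import Summits.QuantumFields.YangMills.Theorems.ColdStartUniversalityLindebergSwapAveragingHaarAC
import Summits.QuantumFields.YangMills.Theorems.ColdStartUniversalityLindebergSwapRegularContinuity
import HarnessLib

/-!
# Crux `ColdStartContinuumCauchy` (stmt-QuantumFields-24810, route `ColdStartUniversality`), LINE 3 «lindeberg_swap»:
# THE IRREGULAR CONFIGURATIONS ARE PRODUCT-HAAR-NULL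

Helper file (seat `ym-line-csu-p1`, g9; `--supports stmt-QuantumFields-24810`).  Brick (a5) of the proof plan for the registered rung
`stub_shortWindowSwap` (memo v3 on the crux), assembling (a1) `…LoopLaw` (the law of a loop variable under product Haar is Haar),
(a2) `…GuardSphereNull` (the guard sphere `{dist1 = δ_SU}` is Haar-null) and (a3) `…AveragingHaarAC` (the iterated averaging pushes
product Haar to absolutely continuous measures): the IRREGULAR set of depth `k`,

  `{V | ∃ i < k, ∃ c x, dist1 (loopHol (Ū^i) c x) = δ_SU}`  (`Ū^i = Averaging.iter blockAvg i V`),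

— outside of which the guarded averaging, `avgField`, `stepDown` and `wdisc` are continuous (`…RegularContinuity`) — is NULL for product
Haar on the level-0 fields (`fieldMeasure_irregular_null`), for product Haar on the configurations (`pi_haar_irregular_null`), and so is
its preimage under the swap map `stepDown` (`pi_haar_stepDown_irregular_null`).  Consequently the laws with a density (brick (ii)) do not
see the discontinuities.  THEOREMS ONLY, no sorry.  HONEST FRAMING: plumbing; no crux, rung or summit is proved; the Yang–Mills mass gap is
NOT proved.
-/

set_option autoImplicit false

noncomputable section

namespace Summit.QuantumFields.YangMills.Cruxes.ColdStartContinuumCauchy.LindebergSwap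

open scoped BigOperators NNReal ENNReal
open MeasureTheory Set Function
open Literature.MathematicalPhysics.QuantumFieldTheory
open Literature.MathematicalPhysics.QuantumFieldTheory.Balaban1983to89
open Literature.MathematicalPhysics.QuantumLattice
open Literature.MathematicalPhysics.QuantumFieldTheory.Balaban1983to89.BlockAveraging (blockAvg loopHol Idx)

variable (F : T3ContinuumYM3Torus.T3Family)

/-- **One guard level set of an iterated average is null**: for `i + 1 ≤ m + K`,
`Haar_0 {V | dist1 (loopHol (Ū^i) c x) = δ_SU} = 0`. [folklore] -/
theorem fieldMeasure_iter_guardLevel_null (K i : ℕ) (hi : i + 1 ≤ F.m + K) (c : PBond (F.P K) (i + 1)) (x : Idx (F.P K)) :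
    fieldMeasure (F.P K) 0 G2 {V : GaugeField (F.P K) 0 G2 |
      dist1 (loopHol (Averaging.iter (fun j => (blockAvg (P := F.P K) (j := j) avSU : Averaging (F.P K) j G2)) i V) c x) =
        (avSU).δ} = 0 := by
  have hN : fieldMeasure (F.P K) i G2 {W : GaugeField (F.P K) i G2 | dist1 (loopHol W c x) = (avSU).δ} = 0 :=
    fieldMeasure_guardLevel_null_of_sphere_null hi c x (avSU).δ_pos.ne' haar_guardSphere_eq_zero
  have hmi : Measurable (Averaging.iter (fun j => (blockAvg (P := F.P K) (j := j) avSU : Averaging (F.P K) j G2)) i) :=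
    T4Continuum.measurable_iter _ (fun j => F.avgMeasurable_of_measurableE avSU T4ApexTwoLevel.measurableE_expMeanLogSU K j) i
  have hAC := map_iter_absolutelyContinuous F K i (Nat.le_of_succ_le hi)
  have h0 := hAC hN
  exact nonpos_iff_eq_zero.mp ((Measure.le_map_apply hmi.aemeasurable _).trans h0.le)

/-- ★ **The irregular level-0 fields of depth `k` are product-Haar-null** (`k ≤ m + K`). [folklore] -/
theorem fieldMeasure_irregular_null (K k : ℕ) (hk : k ≤ F.m + K) :
    fieldMeasure (F.P K) 0 G2 {V : GaugeField (F.P K) 0 G2 | ∃ i, i < k ∧ ∃ (c : PBond (F.P K) (i + 1)) (x : Idx (F.P K)),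
      dist1 (loopHol (Averaging.iter (fun j => (blockAvg (P := F.P K) (j := j) avSU : Averaging (F.P K) j G2)) i V) c x) =
        (avSU).δ} = 0 := by
  have hset : {V : GaugeField (F.P K) 0 G2 | ∃ i, i < k ∧ ∃ (c : PBond (F.P K) (i + 1)) (x : Idx (F.P K)),
      dist1 (loopHol (Averaging.iter (fun j => (blockAvg (P := F.P K) (j := j) avSU : Averaging (F.P K) j G2)) i V) c x) =
        (avSU).δ} = ⋃ i : Fin k, ⋃ c : PBond (F.P K) (i + 1), ⋃ x : Idx (F.P K),
      {V | dist1 (loopHol (Averaging.iter (fun j => (blockAvg (P := F.P K) (j := j) avSU : Averaging (F.P K) j G2)) i V) c x) =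
        (avSU).δ} := by
    ext V
    simp only [Set.mem_setOf_eq, Set.mem_iUnion]
    constructor
    · rintro ⟨i, hi, c, x, h⟩
      exact ⟨⟨i, hi⟩, c, x, h⟩
    · rintro ⟨⟨i, hi⟩, c, x, h⟩
      exact ⟨i, hi, c, x, h⟩
  rw [hset]
  refine measure_iUnion_null fun i => measure_iUnion_null fun c => measure_iUnion_null fun x => ?_
  exact fieldMeasure_iter_guardLevel_null F K i (by have := i.2; omega) c x

/-- **The irregular configurations of depth `k` are product-Haar-null** (`k ≤ m + K`). [folklore] -/
theorem pi_haar_irregular_null (K k : ℕ) (hk : k ≤ F.m + K) :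
    (Measure.pi fun _ : Edge 3 ((F.P K).sitesPerDir 0) => (HaarData.haar : Measure G2))
      {u : GaugeConfig 3 ((F.P K).sitesPerDir 0) G2 | ∃ i, i < k ∧ ∃ (c : PBond (F.P K) (i + 1)) (x : Idx (F.P K)),
        dist1 (loopHol (Averaging.iter (fun j => (blockAvg (P := F.P K) (j := j) avSU : Averaging (F.P K) j G2)) i
          (toField F K u)) c x) = (avSU).δ} = 0 := by
  have hN := fieldMeasure_irregular_null F K k hk
  have hmt : Measurable (toField F K) := measurable_pi_lambda _ fun b => measurable_pi_apply _
  have h := Measure.le_map_apply hmt.aemeasurable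
    {V : GaugeField (F.P K) 0 G2 | ∃ i, i < k ∧ ∃ (c : PBond (F.P K) (i + 1)) (x : Idx (F.P K)),
      dist1 (loopHol (Averaging.iter (fun j => (blockAvg (P := F.P K) (j := j) avSU : Averaging (F.P K) j G2)) i V) c x) =
        (avSU).δ} (μ := Measure.pi fun _ : Edge 3 ((F.P K).sitesPerDir 0) => (HaarData.haar : Measure G2))
  rw [map_toField_pi_haar, hN] at h
  exact nonpos_iff_eq_zero.mp h

/-- **The swap map does not charge the irregular coarse fields**: the fine configurations whose one-step average `stepDown`
(read as a coarse level-0 field) is irregular of depth `k ≤ m + K` form a product-Haar-null set. [folklore] -/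
theorem pi_haar_stepDown_irregular_null (K k : ℕ) (hk : k ≤ F.m + K) :
    (Measure.pi fun _ : Edge 3 ((F.P (K + 1)).sitesPerDir 0) => (HaarData.haar : Measure G2))
      {u' : GaugeConfig 3 ((F.P (K + 1)).sitesPerDir 0) G2 | ∃ i, i < k ∧ ∃ (c : PBond (F.P K) (i + 1)) (x : Idx (F.P K)),
        dist1 (loopHol (Averaging.iter (fun j => (blockAvg (P := F.P K) (j := j) avSU : Averaging (F.P K) j G2)) i
          (toField F K (stepDown F K u'))) c x) = (avSU).δ} = 0 :=
  pi_haar_null_preimage_toField_stepDown F K (fieldMeasure_irregular_null F K k hk)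

/-- **The fine configurations irregular for the FIRST averaging step are product-Haar-null** (the level-0 guard level sets of the
finer approximation; outside them `stepDown` is continuous, `continuousAt_stepDown_of_regular`). [folklore] -/
theorem pi_haar_stepDown_guard_null (K : ℕ) :
    (Measure.pi fun _ : Edge 3 ((F.P (K + 1)).sitesPerDir 0) => (HaarData.haar : Measure G2))
      {u' : GaugeConfig 3 ((F.P (K + 1)).sitesPerDir 0) G2 | ∃ (c : PBond (F.P (K + 1)) 1) (x : Idx (F.P (K + 1))),
        dist1 (loopHol (toField F (K + 1) u') c x) = (avSU).δ} = 0 := by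
  have h := pi_haar_irregular_null F (K + 1) 1 (by have := F.hm; omega)
  have hset : {u' : GaugeConfig 3 ((F.P (K + 1)).sitesPerDir 0) G2 | ∃ (c : PBond (F.P (K + 1)) 1) (x : Idx (F.P (K + 1))),
        dist1 (loopHol (toField F (K + 1) u') c x) = (avSU).δ} =
      {u' : GaugeConfig 3 ((F.P (K + 1)).sitesPerDir 0) G2 | ∃ i, i < 1 ∧ ∃ (c : PBond (F.P (K + 1)) (i + 1))
        (x : Idx (F.P (K + 1))), dist1 (loopHol (Averaging.iter
          (fun j => (blockAvg (P := F.P (K + 1)) (j := j) avSU : Averaging (F.P (K + 1)) j G2)) i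
          (toField F (K + 1) u')) c x) = (avSU).δ} := by
    ext u'
    simp only [Set.mem_setOf_eq, Nat.lt_one_iff, exists_eq_left]
    exact Iff.rfl
  rw [hset]
  exact h

/-! ## Consequence: the swap functional is continuous off a product-Haar-null set -/

/-- **Regular fine configurations**: off a product-Haar-null set of fine configurations, `stepDown K` is continuous AND the coarse
configuration `stepDown K u'` is regular to depth `K` (so `avgField K j`, `j ≤ K`, are continuous there and `wdisc_K(·, stepDown u') → 0`).
[folklore] -/
theorem ae_pi_haar_stepDown_regular (K : ℕ) :
    ∀ᵐ u' ∂(Measure.pi fun _ : Edge 3 ((F.P (K + 1)).sitesPerDir 0) => (HaarData.haar : Measure G2)),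
      ContinuousAt (stepDown F K) u' ∧
        Filter.Tendsto (fun u => wdisc F K u (stepDown F K u')) (nhds (stepDown F K u')) (nhds 0) := by
  have h1 := pi_haar_stepDown_guard_null F K
  have h2 := pi_haar_stepDown_irregular_null F K K (by have := F.hm; omega)
  have hnull := measure_union_null h1 h2
  rw [measure_eq_zero_iff_ae_notMem] at hnull
  filter_upwards [hnull] with u' hu'
  simp only [Set.mem_union, Set.mem_setOf_eq, not_or, not_exists, not_and] at hu'
  refine ⟨continuousAt_stepDown_of_regular F K (fun c x => hu'.1 c x), ?_⟩
  exact tendsto_wdisc_of_regular F K (fun i hi c x => hu'.2 i hi c x)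

end Summit.QuantumFields.YangMills.Cruxes.ColdStartContinuumCauchy.LindebergSwap

end
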